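import Summits.QuantumFields.YangMills.Theorems.FluctuationComparisonRegPrIntLOrganTangentTriangularChart
import Literature.MathematicalPhysics.QuantumFieldTheory.Balaban1983to89.BlockAveragingHaarAC
import Literature.MathematicalPhysics.QuantumFieldTheory.Balaban1983to89.T3UnitScaleTilt
import Literature.MathematicalPhysics.QuantumFieldTheory.Balaban1983to89.T3UnitLawDensityEML
import Literature.MathematicalPhysics.QuantumFieldTheory.Balaban1983to89.T3OrbitAverage
import HarnessLib

/-!
# Crux `FluctuationComparisonRegPrIntL` (stmt-QuantumFields-20520, rung R3), PATH-B organ-tangent lane — THE (C3) MASS FROM A SMALL LIFT,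
# GENERIC CUT: ✓`…OrganTangentMassOfSmallLift` (p782929, LEAD w3 g22) with `3 ∕ 4 ↦ cW`

LEAD-20520 width seat ym-ust-20520-w3 g23 (cell ym3-torus), `--supports stmt-QuantumFields-20520` (helper).  THEOREMS ONLY, def-free; statement and
proof of ★`mass_of_smallLift` are the landed ones BYTE FOR BYTE except that the window constant `3 ∕ 4` is the free binder `(cW : ℝ)` (in (SOL)
`hsol`, (LIFT) `hlift` and the conclusion = the `hmass` binder of ✓`…OrganTangentTriangularChartAnyCut.regularPackage_of_oneVariableInverseLaws`).

WHY A GENERIC-CUT EDITION (R-CUT-χ, LEAD WORD №1 (iii) ∕ ideator ym-r3-idea-1 g26 №3 «GO v2.6 ∕ v17.2», 2026-08-30).  Row VER∘ needs every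
coarse-window fibre of `descend` to meet `{χ > 0} = {PlaqSmall (c₂·θ_{j+1})}`, `c₂θ` the TOP of the cutoff ramp — i.e. exact one-step small lifts with
gain `κ√L ≤ c₂` from a height.  The tree's certified kernels give `κ√L ≤ 0.9482…` at `L = 3` (`CertL3Tree.certL3_clause`), `0.860 ∕ 0.805` at
`L = 5 ∕ 7` (ANSATZ S), `≤ 2∕3` for odd `L ≥ 9` (ANSATZ T): the v2–v2.5 top `cW` is served for `L ≥ 9` only (✓`…SpreadLiftOfSmallLift`), any top in
`(0.9483, 1)` for EVERY odd `L ≥ 3`.  The line therefore re-cut `sfCut` to the ramp `(c₁, c₂) = (1∕2, 24∕25)` (token of record: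
`∏ p, max 0 (min 1 ((24 ∕ 25 * θ − dist1 (plaqHol U p)) ∕ ((24 ∕ 25 − 1 ∕ 2) * θ)))`), and the (A)-currency files are re-issued with the window
constant a FREE real `cW` in place of the literal `3 ∕ 4` (consumers instantiate `cW := 24 ∕ 25`; `cW := 3 ∕ 4` recovers the landed edition).

CONTENT: (REG) the target relation `{(U, v) | v ∈ T c U}` open with `θ c` continuous and `jac c > 0` on it, (SOL) every `cW·θ_{j+1}`-small fine field
sits in its own chart (`descend U c ∈ T c U`, `θ c U (descend U c) = U (β c)`), (LIFT) every window datum has a `cW·θ_{j+1}`-small `descend`-preimage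
(for `cW := 24∕25`: ✓`…SpreadLiftAllL` of px12 g19, every odd `L ≥ 3`; for `cW := 3∕4`: ✓`…SpreadLiftOfSmallLift`, odd `L ≥ 9`) ⟹ positive chart
mass of the `cW`-window over every `V ∈ window_j` (`IsOpenPosMeasure` of product Haar + `lintegral_pos_iff_support`).
[cite: Balaban1985Averaging, (10)-(13) p.19; Balaban1987RG1, (0.18) p.255]

HONEST FRAMING: a mechanical generalisation (`3 ∕ 4 ↦ cW`) of a landed, kernel-checked helper over hypothesis letters; nothing of Bałaban's
analysis is asserted or proved; (A), VER∘ (as a row), LIN∘, JEN∘, O1, crux 20520 `FluctuationComparisonRegPrIntL`, `YM3TorusSU2` are NOT proved; the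
registry `Lines/semiclassical_s2beta.lean` v11.4 (★★OWNER RULING №36) is untouched and nothing here is registered; rung R3 = SU(2) YM₃ on T³ —
NOT d = 4, NOT infinite volume, NOT a mass gap, NOT Clay; the Yang–Mills mass gap is NOT proved by any of this.
-/

set_option autoImplicit false

noncomputable section

namespace Summit.QuantumFields.YangMills.Theorems.OrganTangentMassOfSmallLiftAnyCut

open MeasureTheory Filter Topology Set Function
open scoped ENNReal NNReal
open Literature.MathematicalPhysics.QuantumFieldTheory.Balaban1983to89
open T4Continuum T3ContinuumYM3Torus T3NestedUnitLaws T3UnitLawDensityEML T3UnitScaleTilt T3LevelShift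
open Literature.MathematicalPhysics.QuantumFieldTheory.Balaban1983to89.T3OrbitAverage
open Literature.MathematicalPhysics.QuantumFieldTheory.Balaban1983to89.BlockAveragingHaarAC (centralBond centralBond_injective)
open Summit.QuantumFields.YangMills.Theorems.OrganTangentFibreMeanTools
open Summit.QuantumFields.YangMills.Theorems (OrganTangentTriangularChart.injective_private)

/-! ## The (C3) mass from a small lift -/

section Mass

variable (F : T3Family) (γ b₀ p₀ : ℝ) (j : ℕ) (cW : ℝ)

/-- ★ **THE (C3) MASS FROM A SMALL LIFT + CHART REGULARITY IN THE ENVIRONMENT.**  With `β c := centralBond (bondShift h c)`: if (REG) the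
target relation `{(U, v) | v ∈ T c U}` is open with `θ c` continuous and `jac c` positive on it (`jac c` measurable), (SOL) every `cW·θ_{j+1}`-small
fine field `U` has `descend U c ∈ T c U` and `θ c U (descend U c) = U (β c)`, and (LIFT) every window datum has a `cW·θ_{j+1}`-small lift, then
for every `V ∈ window_j`: `0 < ∫⁻ U in {U | (∀ c, V c ∈ T c U) ∧ PlaqSmall (cW·θ_{j+1}) (extend β (fun c => θ c U (V c)) U)}, ∏ c, jac c U (V c) ∂dU_{j+1}`
— the `hmass` binder of ✓`OrganTangentTriangularChart.regularPackage_of_oneVariableInverseLaws` [folklore]. [cite: Balaban1985Averaging, (10)-(13) p.19; Balaban1987RG1, (0.18) p.255] -/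
theorem mass_of_smallLift
    (T : PBond (F.P j) 0 → GaugeField (F.P (j + 1)) 0 ↥(Matrix.specialUnitaryGroup (Fin 2) ℂ) → Set ↥(Matrix.specialUnitaryGroup (Fin 2) ℂ))
    (θ : PBond (F.P j) 0 → GaugeField (F.P (j + 1)) 0 ↥(Matrix.specialUnitaryGroup (Fin 2) ℂ) →
      ↥(Matrix.specialUnitaryGroup (Fin 2) ℂ) → ↥(Matrix.specialUnitaryGroup (Fin 2) ℂ))
    (jac : PBond (F.P j) 0 → GaugeField (F.P (j + 1)) 0 ↥(Matrix.specialUnitaryGroup (Fin 2) ℂ) → ↥(Matrix.specialUnitaryGroup (Fin 2) ℂ) → ℝ≥0)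
    (hTo : ∀ c, IsOpen {p : GaugeField (F.P (j + 1)) 0 ↥(Matrix.specialUnitaryGroup (Fin 2) ℂ) × ↥(Matrix.specialUnitaryGroup (Fin 2) ℂ) |
      p.2 ∈ T c p.1})
    (hθc : ∀ c, ContinuousOn (fun p : GaugeField (F.P (j + 1)) 0 ↥(Matrix.specialUnitaryGroup (Fin 2) ℂ) × ↥(Matrix.specialUnitaryGroup (Fin 2) ℂ) =>
      θ c p.1 p.2) {p | p.2 ∈ T c p.1})
    (hjm : ∀ c, Measurable fun p : GaugeField (F.P (j + 1)) 0 ↥(Matrix.specialUnitaryGroup (Fin 2) ℂ) × ↥(Matrix.specialUnitaryGroup (Fin 2) ℂ) =>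
      jac c p.1 p.2)
    (hjpos : ∀ c U v, v ∈ T c U → 0 < jac c U v)
    (hsol : ∀ U : GaugeField (F.P (j + 1)) 0 ↥(Matrix.specialUnitaryGroup (Fin 2) ℂ), PlaqSmall (cW * θBal F.L γ b₀ p₀ (j + 1)) U →
      ∀ c, descend F ℰp j U c ∈ T c U ∧ θ c U (descend F ℰp j U c) = U (centralBond (bondShift (sitesPerDir_descend F j 0) c)))
    (hlift : ∀ V : GaugeField (F.P j) 0 ↥(Matrix.specialUnitaryGroup (Fin 2) ℂ), PlaqSmall (θBal F.L γ b₀ p₀ j) V →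
      ∃ U₀ : GaugeField (F.P (j + 1)) 0 ↥(Matrix.specialUnitaryGroup (Fin 2) ℂ),
        descend F ℰp j U₀ = V ∧ PlaqSmall (cW * θBal F.L γ b₀ p₀ (j + 1)) U₀) :
    ∀ V : GaugeField (F.P j) 0 ↥(Matrix.specialUnitaryGroup (Fin 2) ℂ), PlaqSmall (θBal F.L γ b₀ p₀ j) V →
      0 < ∫⁻ U in {U : GaugeField (F.P (j + 1)) 0 ↥(Matrix.specialUnitaryGroup (Fin 2) ℂ) | (∀ c, V c ∈ T c U) ∧
          PlaqSmall (cW * θBal F.L γ b₀ p₀ (j + 1))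
            (extend (fun c : PBond (F.P j) 0 => centralBond (bondShift (sitesPerDir_descend F j 0) c)) (fun c => θ c U (V c)) U)},
        ∏ c, (jac c U (V c) : ℝ≥0∞) ∂(fieldMeasure (F.P (j + 1)) 0 ↥(Matrix.specialUnitaryGroup (Fin 2) ℂ)) := by
  classical
  intro V hV
  set β : PBond (F.P j) 0 → PBond (F.P (j + 1)) 0 := fun c => centralBond (bondShift (sitesPerDir_descend F j 0) c) with hβ
  have hβi : Injective β := OrganTangentTriangularChart.injective_private F j
  set θ' : ℝ := θBal F.L γ b₀ p₀ (j + 1) with hθ'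
  haveI : BorelSpace (GaugeField (F.P (j + 1)) 0 ↥(Matrix.specialUnitaryGroup (Fin 2) ℂ)) := T3OrbitAverage.instBorelSpaceGaugeField
  haveI : (fieldMeasure (F.P (j + 1)) 0 ↥(Matrix.specialUnitaryGroup (Fin 2) ℂ)).IsOpenPosMeasure :=
    B12ContinuousTransportInvariance.isOpenPosMeasure_fieldMeasure_SU 2 (F.P (j + 1)) 0
  -- the good set of environments and the chart over it
  set G : Set (GaugeField (F.P (j + 1)) 0 ↥(Matrix.specialUnitaryGroup (Fin 2) ℂ)) := {U | ∀ c, V c ∈ T c U} with hG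
  set Ψ : GaugeField (F.P (j + 1)) 0 ↥(Matrix.specialUnitaryGroup (Fin 2) ℂ) → GaugeField (F.P (j + 1)) 0 ↥(Matrix.specialUnitaryGroup (Fin 2) ℂ) :=
    fun U => extend β (fun c => θ c U (V c)) U with hΨ
  set O : Set (GaugeField (F.P (j + 1)) 0 ↥(Matrix.specialUnitaryGroup (Fin 2) ℂ)) := {U | PlaqSmall (cW * θ') U} with hO
  have hOopen : IsOpen O := by
    have e : O = ⋂ p : Plaq (F.P (j + 1)) 0, {U | dist1 (GaugeField.plaqHol U p) < cW * θ'} := by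
      ext U; simp only [hO, PlaqSmall, Set.mem_setOf_eq, Set.mem_iInter]
    rw [e]
    exact isOpen_iInter_of_finite fun p => isOpen_lt (continuous_dist1_plaqHol p) continuous_const
  have hGopen : IsOpen G := by
    have e : G = ⋂ c, (fun U : GaugeField (F.P (j + 1)) 0 ↥(Matrix.specialUnitaryGroup (Fin 2) ℂ) => (U, V c)) ⁻¹'
        {p : GaugeField (F.P (j + 1)) 0 ↥(Matrix.specialUnitaryGroup (Fin 2) ℂ) × ↥(Matrix.specialUnitaryGroup (Fin 2) ℂ) | p.2 ∈ T c p.1} := by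
      ext U; simp only [hG, Set.mem_setOf_eq, Set.mem_iInter, Set.mem_preimage]
    rw [e]
    exact isOpen_iInter_of_finite fun c => (hTo c).preimage (Continuous.prodMk_left (V c))
  -- the chart is continuous on the good set (coordinate by coordinate)
  have hΨc : ContinuousOn Ψ G := by
    refine continuousOn_pi.2 fun b => ?_
    by_cases hb : ∃ c, β c = b
    · obtain ⟨c, rfl⟩ := hb
      have e : ∀ U, Ψ U (β c) = θ c U (V c) := fun U => hβi.extend_apply _ _ c
      simp_rw [e]
      exact (hθc c).comp (Continuous.prodMk_left (V c)).continuousOn fun U hU => hU c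
    · have e : ∀ U, Ψ U b = U b := fun U => extend_apply' _ _ _ hb
      simp_rw [e]
      exact (continuous_apply b).continuousOn
  -- the integration set `= G ∩ Ψ ⁻¹' O` (definitionally) is open …
  have hAopen : IsOpen (G ∩ Ψ ⁻¹' O) := hΨc.isOpen_inter_preimage hGopen hOopen
  -- … and contains the lift
  obtain ⟨U₀, hU₀V, hU₀s⟩ := hlift V hV
  have hU₀G : U₀ ∈ G := fun c => by
    rw [show V c = descend F ℰp j U₀ c by rw [hU₀V]]
    exact (hsol U₀ hU₀s c).1
  have hΨU₀ : Ψ U₀ = U₀ := by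
    funext b
    by_cases hb : ∃ c, β c = b
    · obtain ⟨c, rfl⟩ := hb
      rw [show Ψ U₀ (β c) = θ c U₀ (V c) from hβi.extend_apply _ _ c,
        show V c = descend F ℰp j U₀ c by rw [hU₀V]]
      exact (hsol U₀ hU₀s c).2
    · exact extend_apply' _ _ _ hb
  have hU₀A : U₀ ∈ G ∩ Ψ ⁻¹' O := ⟨hU₀G, by rw [Set.mem_preimage, hΨU₀]; exact hU₀s⟩
  have hApos : 0 < fieldMeasure (F.P (j + 1)) 0 ↥(Matrix.specialUnitaryGroup (Fin 2) ℂ) (G ∩ Ψ ⁻¹' O) :=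
    hAopen.measure_pos _ ⟨U₀, hU₀A⟩
  -- the integrand is measurable and positive on the set
  have hfm : Measurable fun U : GaugeField (F.P (j + 1)) 0 ↥(Matrix.specialUnitaryGroup (Fin 2) ℂ) => ∏ c, (jac c U (V c) : ℝ≥0∞) := by
    refine Finset.measurable_prod _ fun c _ => ?_
    exact measurable_coe_nnreal_ennreal.comp ((hjm c).comp (measurable_prodMk_right : Measurable fun U :
      GaugeField (F.P (j + 1)) 0 ↥(Matrix.specialUnitaryGroup (Fin 2) ℂ) => (U, V c)))
  have hfne : ∀ U ∈ G ∩ Ψ ⁻¹' O, (∏ c, (jac c U (V c) : ℝ≥0∞)) ≠ 0 := by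
    intro U hU
    exact Finset.prod_ne_zero_iff.2 fun c _ => ENNReal.coe_ne_zero.2 (hjpos c U (V c) (hU.1 c)).ne'
  show 0 < ∫⁻ U in G ∩ Ψ ⁻¹' O, ∏ c, (jac c U (V c) : ℝ≥0∞) ∂(fieldMeasure (F.P (j + 1)) 0 ↥(Matrix.specialUnitaryGroup (Fin 2) ℂ))
  rw [lintegral_pos_iff_support hfm, Measure.restrict_apply' hAopen.measurableSet]
  refine hApos.trans_le (measure_mono fun U hU => ⟨Function.mem_support.2 (hfne U hU), hU⟩)

end Mass

end Summit.QuantumFields.YangMills.Theorems.OrganTangentMassOfSmallLiftAnyCut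

end
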